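import Summits.ValiantsHypothesis.ValiantsHypothesis.Theorems.KPlusLogSqLawRealTauFatStrip
import Summits.ValiantsHypothesis.ValiantsHypothesis.Theorems.LacunarySymmetroidMatrixDescartesCensusTropicalKLaw
import Summits.ValiantsHypothesis.ValiantsHypothesis.Theses.KPlusLogSqLaw

/-!
# Route «KPlusLogSqLaw» (items stmt-ValiantsHypothesis-19561 `WeakLifting`, -19772 `Lifting`, crux `NotB`) — under Koiran's real
# τ-conjecture the route's real-side cruxes SHRINK to the thin strip `K < (⌊√m⌋+1)(⌊log₂ m⌋+⌊log₂ K⌋+3)`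

HONEST FRAMING.  Def-free helper (`--supports stmt-ValiantsHypothesis-19561`), sequel of `…KPlusLogSqLawRealTauFatStrip`
(`realRootLawAt_fatStrip_of_realTau : KoiranRealTauConjecture → ∃ C, ∀ m K, (⌊√m⌋+1)(⌊log₂m⌋+⌊log₂K⌋+3) ≤ K → RealRootLawAt m K (2^{CK})`).
Nothing here asserts `WeakLifting`, `Lifting`, `NotB`, Conjecture B, the real τ-conjecture or anything on VP ≠ VNP: every statement is an
equivalence UNDER the open hypothesis `Literature…KoiranRealTauConjecture`.  BY NAME (route decls of `Theses/KPlusLogSqLaw.lean`, whose inline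
tropical hypothesis is δ-equal to `TropicalCensus.TropRootLawAt`):

* `weakLifting_iff_thinStrip_of_realTau` — `KoiranRealTauConjecture → (WeakLifting ↔ its restriction to K < (⌊√m⌋+1)(⌊log₂m⌋+⌊log₂K⌋+3))`;
* `lifting_iff_thinStrip_of_realTau` — the same for `Lifting` (registered stubs `stub_liftThin`/`stub_liftFat` of `Cruxes/Lifting/Lines/birth.lean`:
  under real-τ the fat stub is needed only below `√m·log(mK)`);
* `notB_iff_thinStrip_of_realTau` — the same for the refutation crux `NotB` (Conjecture B fails iff it fails in the thin strip).
[folklore] glue.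
-/

set_option linter.dupNamespace false
set_option autoImplicit false

namespace Summit.ValiantsHypothesis.ValiantsHypothesis.Theorems.KPlusLogSqLaw.RealTauFatStrip

open Literature.Computability.AlgebraicComplexity
open Summit.ValiantsHypothesis.ValiantsHypothesis.Theorems.LacunarySymmetroidMatrixDescartes
open Summit.ValiantsHypothesis.ValiantsHypothesis.Theorems.LacunarySymmetroidMatrixDescartes.Census (realRootLawAt_mono)
open Summit.ValiantsHypothesis.ValiantsHypothesis.Theorems.LacunarySymmetroidMatrixDescartes.TropicalCensus (TropRootLawAt)
open Summit.ValiantsHypothesis.ValiantsHypothesis.Theses.KPlusLogSqLaw (WeakLifting Lifting NotB)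

/-- exponent bookkeeping: `C₁·K ≤ (C₁+C₂)·(K + L²)` and `C₂·X ≤ (C₁+C₂)·X`. [folklore] -/
theorem pow_mono_aux (C₁ C₂ K L : ℕ) : 2 ^ (C₁ * K) ≤ 2 ^ ((C₁ + C₂) * (K + L)) :=
  Nat.pow_le_pow_right (by norm_num) (Nat.mul_le_mul (by omega) (by omega))

/-- **`WeakLifting` under the real τ-conjecture ⟺ its thin-strip restriction.** [folklore] -/
theorem weakLifting_iff_thinStrip_of_realTau (hτ : KoiranRealTauConjecture) :
    WeakLifting ↔ ∃ C : ℕ, ∀ m K n : ℕ, K < (Nat.sqrt m + 1) * (Nat.log 2 m + Nat.log 2 K + 3) →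
      TropRootLawAt m K n → RealRootLawAt m K (2 ^ (C * (K + Nat.log 2 m ^ 2)) * (n + 1)) := by
  constructor
  · rintro ⟨C, hC⟩
    exact ⟨C, fun m K n _ h => hC m K n h⟩
  · rintro ⟨C₂, h₂⟩
    obtain ⟨C₁, h₁⟩ := realRootLawAt_fatStrip_of_realTau hτ
    refine ⟨C₁ + C₂, fun m K n htrop => ?_⟩
    by_cases hK : (Nat.sqrt m + 1) * (Nat.log 2 m + Nat.log 2 K + 3) ≤ K
    · refine realRootLawAt_mono ?_ (h₁ m K hK)
      calc 2 ^ (C₁ * K) ≤ 2 ^ ((C₁ + C₂) * (K + Nat.log 2 m ^ 2)) := pow_mono_aux _ _ _ _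
        _ ≤ 2 ^ ((C₁ + C₂) * (K + Nat.log 2 m ^ 2)) * (n + 1) := Nat.le_mul_of_pos_right _ (Nat.succ_pos n)
    · refine realRootLawAt_mono ?_ (h₂ m K n (by omega) htrop)
      exact Nat.mul_le_mul_right _ (Nat.pow_le_pow_right (by norm_num) (Nat.mul_le_mul_right _ (by omega)))

/-- **`Lifting` under the real τ-conjecture ⟺ its thin-strip restriction.** [folklore] -/
theorem lifting_iff_thinStrip_of_realTau (hτ : KoiranRealTauConjecture) :
    Lifting ↔ ∃ C : ℕ, ∀ m K n : ℕ, K < (Nat.sqrt m + 1) * (Nat.log 2 m + Nat.log 2 K + 3) →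
      TropRootLawAt m K n → RealRootLawAt m K (2 ^ (C * K) * (n + 1)) := by
  constructor
  · rintro ⟨C, hC⟩
    exact ⟨C, fun m K n _ h => hC m K n h⟩
  · rintro ⟨C₂, h₂⟩
    obtain ⟨C₁, h₁⟩ := realRootLawAt_fatStrip_of_realTau hτ
    refine ⟨C₁ + C₂, fun m K n htrop => ?_⟩
    by_cases hK : (Nat.sqrt m + 1) * (Nat.log 2 m + Nat.log 2 K + 3) ≤ K
    · refine realRootLawAt_mono ?_ (h₁ m K hK)
      calc 2 ^ (C₁ * K) ≤ 2 ^ ((C₁ + C₂) * (K + 0)) := pow_mono_aux _ _ _ _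
        _ ≤ 2 ^ ((C₁ + C₂) * K) * (n + 1) := by rw [add_zero]; exact Nat.le_mul_of_pos_right _ (Nat.succ_pos n)
    · refine realRootLawAt_mono ?_ (h₂ m K n (by omega) htrop)
      exact Nat.mul_le_mul_right _ (Nat.pow_le_pow_right (by norm_num) (Nat.mul_le_mul_right _ (by omega)))

/-- **`NotB` under the real τ-conjecture ⟺ Conjecture B fails in the thin strip.** [folklore] -/
theorem notB_iff_thinStrip_of_realTau (hτ : KoiranRealTauConjecture) :
    NotB ↔ ¬ ∃ C : ℕ, ∀ m K : ℕ, K < (Nat.sqrt m + 1) * (Nat.log 2 m + Nat.log 2 K + 3) →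
      RealRootLawAt m K (2 ^ (C * (K + Nat.log 2 m ^ 2))) := by
  refine not_congr ⟨?_, ?_⟩
  · rintro ⟨C, hC⟩
    exact ⟨C, fun m K _ => hC m K⟩
  · rintro ⟨C₂, h₂⟩
    obtain ⟨C₁, h₁⟩ := realRootLawAt_fatStrip_of_realTau hτ
    refine ⟨C₁ + C₂, fun m K => ?_⟩
    by_cases hK : (Nat.sqrt m + 1) * (Nat.log 2 m + Nat.log 2 K + 3) ≤ K
    · exact realRootLawAt_mono (pow_mono_aux _ _ _ _) (h₁ m K hK)
    · refine realRootLawAt_mono ?_ (h₂ m K (by omega))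
      exact Nat.pow_le_pow_right (by norm_num) (Nat.mul_le_mul_right _ (by omega))

/-! ## Kill switches (appended): fat-strip witnesses against Conjecture B refute the real τ-conjecture -/

/-- **KILL SWITCH (real side).**  A family of real symmetric lacunary pencils beating `2^{C·K}` real zeros INSIDE THE FAT STRIP
`(⌊√m⌋+1)(⌊log₂ m⌋+⌊log₂ K⌋+3) ≤ K`, for every `C`, refutes Koiran's real τ-conjecture. [folklore] -/
theorem not_realTau_of_fatStrip_witnesses
    (h : ∀ C : ℕ, ∃ m K : ℕ, (Nat.sqrt m + 1) * (Nat.log 2 m + Nat.log 2 K + 3) ≤ K ∧ ¬ RealRootLawAt m K (2 ^ (C * K))) :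
    ¬ KoiranRealTauConjecture := by
  intro hτ
  obtain ⟨C, hC⟩ := realRootLawAt_fatStrip_of_realTau hτ
  obtain ⟨m, K, hK, hnot⟩ := h C
  exact hnot (hC m K hK)

/-- **KILL SWITCH, by name.**  If Conjecture B FAILS (`NotB`) although it holds in the thin strip, the real τ-conjecture is false —
equivalently, under real-τ every `NotB` witness family must live in the thin strip `K < (⌊√m⌋+1)(⌊log₂ m⌋+⌊log₂ K⌋+3)`. [folklore] -/
theorem not_realTau_of_notB_of_thinStrip (hN : NotB)
    (hthin : ∃ C : ℕ, ∀ m K : ℕ, K < (Nat.sqrt m + 1) * (Nat.log 2 m + Nat.log 2 K + 3) →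
      RealRootLawAt m K (2 ^ (C * (K + Nat.log 2 m ^ 2)))) :
    ¬ KoiranRealTauConjecture := fun hτ =>
  (notB_iff_thinStrip_of_realTau hτ).mp hN hthin

end Summit.ValiantsHypothesis.ValiantsHypothesis.Theorems.KPlusLogSqLaw.RealTauFatStrip
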